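import Summits.CriticalPhenomena.SAWScalingLimit.Theses.SAWLeftRightFKG

/-!
# Sketch — crux `FKGToTraversalBound` (stmt-CriticalPhenomena-1878), ideator 2, round 1
# card `carve-reroot-drill`

First lemmas of the line "carve, re-root, drill": left–right positive association (the route's
`LeftRightFKG`) deletes the past and the outside world from Kemppainen–Smirnov's Condition G2, so
that the crux is equivalent to an UNCONDITIONED, ROOTED annulus bound for lip-to-lip chords of
one-colour lattice rooms (`RootedAnnulusBound`), plus the Kemppainen–Smirnov downstream
(`KSDownstream`, G2 ⇒ Aizenman–Burchard (H1), arXiv:1212.6215 Lemma 3.6 / Prop. "cond ⇒ aizbur",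
which needs only the domain Markov property of the curve law).

Nothing here is proved except the composition `crux_of`; every `def … : Prop` elaborates.
-/

namespace Summit.CriticalPhenomena.SAWScalingLimit.Cruxes.FKGToTraversalBound.CarveRerootDrill

open Literature.Probability.LatticeModels Literature.Probability.RandomPlanarGeometry
open Summit.CriticalPhenomena.SAWScalingLimit.Theses.SAWLeftRightFKG

noncomputable section

/-- The lattice domain enclosed by a closed lattice walk `C` at mesh `δ` (slits allowed): the
points of non-zero winding number of the mesh polyline of `C` — verbatim the `Ω` of the route's
`LeftRightFKG`. -/
def encl (δ : ℝ) {c : Site 2} (C : (zdGraph 2).Walk c c) : Set ℂ :=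
  {z | Literature.Topology.PlaneTopology.wind
      (fun t : ℝ => Set.IccExtend zero_le_one (C.toCurve (meshPoint δ)) t - z) ≠ 0}

/-- The route's left–right order on chords of `encl δ C` from `a` to `b` (lens loop has winding
`≥ 0` everywhere) — verbatim the `le` of `LeftRightFKG`. -/
def lr (δ : ℝ) {c : Site 2} (C : (zdGraph 2).Walk c c) (a b : Site 2)
    (γ₁ γ₂ : SAW.DomainSAW (encl δ C) δ a b) : Prop :=
  ∀ z : ℂ, 0 ≤ Literature.Topology.PlaneTopology.wind
    (fun t : ℝ => Set.IccExtend zero_le_one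
      ((γ₁.walk.append γ₂.walk.reverse).toCurve (meshPoint δ)) t - z)

/-- **Carving core** (the only consequence of PA the line consumes): an `lr`-UP-closed event and an
`lr`-DOWN-closed event are NEGATIVELY correlated, `w(E ∩ D)·w(univ) ≤ w(E)·w(D)`.  With
`D = {γ avoids a hull attached to one boundary arc}` (whose law-conditioning is, by the SAW
restriction property, the chord law of the CARVED domain) and `E = {γ enters a pocket attached to
the other arc}`, this is the carving monotonicity `P_Ω(E) ≤ P_{Ω∖H}(E)`.  Immediate from
`LeftRightFKG` applied to `E` and `Dᶜ` (finite total weight).  Exact-enumeration check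
(exp/carve.py): 0 violations at x ∈ {1/2.7, x_c, 1/2.6} on all boxes ≤ 6×4, 5×5; FAILS at x = 1. -/
def CarveCore : Prop :=
  ∀ (δ : ℝ) (c a b a' b' : Site 2) (C : (zdGraph 2).Walk c c), 0 < δ → a' ∈ C.support →
    b' ∈ C.support → (zdGraph 2).Adj a a' → (zdGraph 2).Adj b b' →
    ∀ E D : Set (SAW.DomainSAW (encl δ C) δ a b),
      (∀ γ₁ γ₂, lr δ C a b γ₁ γ₂ → γ₁ ∈ E → γ₂ ∈ E) →
      (∀ γ₁ γ₂, lr δ C a b γ₁ γ₂ → γ₂ ∈ D → γ₁ ∈ D) →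
      SAW.weight (encl δ C) δ a b (E ∩ D) * SAW.weight (encl δ C) δ a b Set.univ ≤
        SAW.weight (encl δ C) δ a b E * SAW.weight (encl δ C) δ a b D

/-- **Rooted annulus bound** — the re-rooted (lip-to-lip) form of Kemppainen–Smirnov's Condition
G2 for the critical square-lattice SAW, to which carving + re-rooting reduce the crux.  A ROOM is a
lattice domain `encl δ (W₁ ++ W₂)` whose boundary walk is split into the LINTEL `W₁ : u' → v'` and
the WALLS `W₂ : v' → u'`; the chord runs between the two LIPS `u ∼ u'`, `v ∼ v'`.  If the lintel
stays outside `B(z₀, C₀ r)` then the chord meets the closed ball `B̄(z₀, r)` with probability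
`≤ 1/2` — uniformly in the mesh, the room (walls arbitrary: fractal, slit, with bag) and the
position of the target.  Mesh floor `δ ≤ r` (typing moral of the sibling crux's refuted
`AnnulusPairingGap`); `C₀` chosen first; `law` is `0` (junk) or a probability measure, and for
`C₀ ≥ 3` the event is never forced (the sites along the lintel avoid `B̄(z₀, r)`), so no degenerate
instance decides it.  Conjecturally true (SLE₈/₃: boundary one-arm exponent 2, bulk `5/48`…);
its lattice-width-2 mouths contain the critical-bubble tail (see the card, "Why it might fail").
Exact enumeration (exp/carve.py, rooms ≤ 6×5, r = δ): P decays ≈ 3× per row of depth; all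
instances with lintel distance ≥ 3r have P ≤ 0.40. -/
def RootedAnnulusBound : Prop :=
  ∃ C₀ : ℝ, 1 < C₀ ∧ ∀ (δ : ℝ) (u v u' v' : Site 2) (W₁ : (zdGraph 2).Walk u' v')
    (W₂ : (zdGraph 2).Walk v' u') (z₀ : ℂ) (r : ℝ), 0 < δ → δ ≤ r →
    (zdGraph 2).Adj u u' → (zdGraph 2).Adj v v' →
    (∀ s ∈ W₁.support, C₀ * r ≤ dist (meshPoint δ s) z₀) →
    SAW.law (encl δ (W₁.append W₂)) δ u v
      {γ | ∃ s ∈ γ.walk.support, dist (meshPoint δ s) z₀ ≤ r} ≤ 1 / 2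


/-- The **T-domain** `Ω_T(L, s)`: the open lattice box of half-size `L` minus the closed upper
half-box `{|x| ≤ s, 0 ≤ y ≤ s}` (a flat CEILING of half-width `s` with the room below it) and minus
the MAST `{x = 0, y ≥ 0}` (the slit that keeps the ceiling on the boundary after maximal
excavation).  Mesh `1`. -/
def tDomain (L s : ℕ) : Set ℂ :=
  {z | |z.re| < (L : ℝ) + 1 ∧ |z.im| < (L : ℝ) + 1} \
    ({z | |z.re| ≤ (s : ℝ) ∧ 0 ≤ z.im ∧ z.im ≤ (s : ℝ)} ∪ {z | z.re = 0 ∧ 0 ≤ z.im})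

/-- The lintel sites of the T-domain problem: the ceiling sites `(k, 0)`, `0 ≤ k ≤ n`, above the
chord's lips `(0,-1)` and `(n,-1)`. -/
def lintelPts (n : ℕ) : Set ℂ :=
  (fun k : ℕ => meshPoint 1 ![(k : ℤ), 0]) '' {k | k ≤ n}

/-- **T-exit bound** — the canonical DRILLED, CLEAN-MOUTH special case of `RootedAnnulusBound`.
By EXCAVATE (legal on both walls after re-rooting) the rooted bound depends on a room only through
its geometry inside the `s`-neighbourhood of the lintel, glued to the slit plane outside; when that
local geometry is a flat ceiling, the extremal room is the T-domain: the critical chord between the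
lips `(0,-1)` and `(n,-1)` under a flat ceiling, in the plane minus (ceiling block ∪ mast) cut off at
size `L`, leaves the `s`-neighbourhood of its lintel with law `≤ 1/2` as soon as `s ≥ C₀ n`,
uniformly in `n, s, L` (mesh `1`, naturals: immune to coarse-mesh junk; monotone in `L` by FILL, so
the content is the `L → ∞` limit).  A statement with no domain parameter left — "x_c-arches under a
flat ceiling are tight at their own scale"; open. -/
def TExitBound : Prop :=
  ∃ C₀ : ℝ, 1 < C₀ ∧ ∀ n s L : ℕ, 1 ≤ n → C₀ * n ≤ s → 2 * s ≤ L →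
    SAW.law (tDomain L s) 1 ![0, -1] ![(n : ℤ), -1]
      {γ | ∃ v ∈ γ.walk.support, (s : ℝ) ≤ Metric.infDist (meshPoint 1 v) (lintelPts n)} ≤ 1 / 2

/-- The AVOIDABLE part `A^u` of the annulus `A(z₀, r, R)` in the lattice domain `encl δ C` seen
from the marked points `a, b` (Kemppainen–Smirnov, arXiv:1212.6215, Def. 2.2 at time zero): the
points of `Ω ∩ A` whose connected component in `Ω ∩ A` does not disconnect `a` from `b` in `Ω`. -/
def avoidable (δ : ℝ) {c : Site 2} (C : (zdGraph 2).Walk c c) (a b : Site 2) (z₀ : ℂ) (r R : ℝ) :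
    Set ℂ :=
  {z | z ∈ encl δ C ∧ r < dist z z₀ ∧ dist z z₀ < R ∧
    JoinedIn (encl δ C \ connectedComponentIn (encl δ C ∩ {y | r < dist y z₀ ∧ dist y z₀ < R}) z)
      (meshPoint δ a) (meshPoint δ b)}

/-- **Condition G2 for the critical SAW, at time zero over ALL lattice domains** (slits allowed).
Because the SAW chord law is exactly domain-Markov (the conditional law of the future given
`γ[0,τ]` is the chord law of the slit domain from the tip), this is Kemppainen–Smirnov's Condition
G2 with stopping times for the family of critical SAW laws.  An unforced crossing: a segment of
the chord from outside `B(z₀, R)` to inside `B̄(z₀, r)` (or back) whose interior sites lie in the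
avoidable set. -/
def UnforcedCrossingBound : Prop :=
  ∃ C₀ : ℝ, 1 < C₀ ∧ ∀ (δ : ℝ) (c a b a' b' : Site 2) (C : (zdGraph 2).Walk c c) (z₀ : ℂ)
    (r R : ℝ), 0 < δ → δ ≤ r → C₀ * r ≤ R → a' ∈ C.support → b' ∈ C.support →
    (zdGraph 2).Adj a a' → (zdGraph 2).Adj b b' →
    SAW.law (encl δ C) δ a b
      {γ | ∃ i j : ℕ, i < j ∧ j ≤ γ.walk.length ∧
        ((R ≤ dist (meshPoint δ (γ.walk.getVert i)) z₀ ∧ dist (meshPoint δ (γ.walk.getVert j)) z₀ ≤ r)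
          ∨ (R ≤ dist (meshPoint δ (γ.walk.getVert j)) z₀ ∧ dist (meshPoint δ (γ.walk.getVert i)) z₀ ≤ r)) ∧
        ∀ k : ℕ, i < k → k < j → meshPoint δ (γ.walk.getVert k) ∈ avoidable δ C a b z₀ r R}
      < 1 / 2

/-- **Re-rooting** (the new mathematics of the line, stated): carving the arc opposite to an
avoidable one-colour component down to width-one collars (via `CarveCore`, i.e. `LeftRightFKG`)
and the domain Markov property at the collar necks bound every unforced-crossing probability by a
rooted one, so the rooted bound gives Condition G2. -/
def Reroot : Prop :=
  LeftRightFKG → RootedAnnulusBound → UnforcedCrossingBound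

/-- **Kemppainen–Smirnov downstream** (vendorable: arXiv:1212.6215 Lemma 3.6 + proof of
Prop. "Condition G2 ⇒ Aizenman–Burchard", using only domain Markov; in-tree templates
`fkInterface_traversalBound_of_annulusCrossing_le`, `Percolation.bondExploration_traversalBound_holds`
for the shell-dependent threshold bookkeeping): G2 for the critical SAW gives the route's
`SAWTraversalBound`. -/
def KSDownstream : Prop :=
  UnforcedCrossingBound → SAWTraversalBound

/-- Composition: the line concludes the crux BY NAME. -/
theorem crux_of (hR : Reroot) (hK : KSDownstream) (hS : RootedAnnulusBound) :
    FKGToTraversalBound :=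
  fun hPA => hK (hR hPA hS)

end

end Summit.CriticalPhenomena.SAWScalingLimit.Cruxes.FKGToTraversalBound.CarveRerootDrill
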